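import Summits.QuantumFields.YangMills.Theorems.BalabanUVNodesN15BackgroundUnitWords
import Summits.QuantumFields.YangMills.Theorems.BalabanUVNodesN15UnitReadout
import Summits.QuantumFields.YangMills.Theorems.BalabanUVNodesN15BackgroundSiteByName
import HarnessLib

/-!
# Route «BalabanUVNodes» (K4 «SpineRates»), node N15 = NE2 — THE UNIT-LATTICE LAYER WITH THE BACKGROUND LIVE, II: `T4EtaRate.NE2PlusUnit` BY NAME on g3's gauge paired
# instances — the dressed unit covariance `[a − a²Q(U′U)G(U′U)Q*(U′U)]⁻¹` with the (3.60)-shaped full perturbation `V′(A′)` LIVE (the SAME instances and perturbation as F15's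
# `ne2PlusOperator_vWGC` and S5's `ne2PlusSite_vWGC`), for ANY block-local averaging species

Cell `pub-ymgap`, seat `pub-ymgap-dag-n15-c` (generation g5; R134 ACCELERATION SEAT, strategy s1; HUMAN RULING D-0062; chair R424 venue; `bears_on: R4∕N15`).  Filed
`--supports stmt-QuantumFields-20292 --as helper` (K3⁗; count-neutral).  Imports this seat's U1 `…N15BackgroundUnitWords` (`unitForm`, `hasMaj_idef_dressedUnit`, `cAmpU`, `uAmp`),
U2 `…N15UnitReadout` (`etaRateIneqUnit_opGeo_of_hasMaj`), S5 `…N15BackgroundSiteByName` (`site_thresholds`) and through them g4's F14 `vWC_letters_of_gauge` BY NAME; nothing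
in the tree is modified.

WHAT THIS FILE IS (the unit twin of S5).  §1 `cLinU`, `cAmpU_le_lin` (the unit guard from `a₀ ≤ a₂`).  §2 ★ `hasMaj_idef_vWUnitC` — PER CONFIGURATION, the η-defect of the dressed
unit covariances `≤ uAmp·θ·e^{−(δ−4σ)d}`.  §3 `vWUnitOpsC`, `vWGCUnitKernel`, ★★ **`ne2PlusUnit_vWGC`** — `NE2PlusUnit c₃₅` BY NAME (`inΛ = ⊤`, `unitDist = d`, clean rate `θ₀`
with `θ_i ≤ θ₀^{k_i}`).  With F15 ∕ S5 this puts ALL THREE conjuncts of `YMDAG.UVSplit.N15At` on ONE background-live family with every perturbation ∕ species input a letter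
dischargeable from (3.35); displayed: the `U ≡ 1` layer, the `U ≡ 1` site kernels and the `U ≡ 1` unit covariances — the sequel inhabits all three at the vector piece ⊗ 1_𝔤.

HONEST FRAMING ∕ LIMITS.  The `U ≡ 1` UNIT COVARIANCES `W_s, W_s′` (inverse of `a − a²QGQ*` with a decaying majorant — King's `C^{(k)}`-type object at `U ≡ 1`, [King1986]
(4.33); for the lineage's single-scale vector PIECE a formal analogue, since King's identity holds for the FULL `G_k`) are DISPLAYED hypotheses, as are the `U ≡ 1` layer's
letters; transport = fibrewise mean (linearised (C3)); single-scale unit torus; the (3.36) slot of the quantifier block is not consumed.  Nothing about Bałaban's `C^{(k)}(Λ;U)`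
is asserted; NE2⁺ NOT PRINTED, NOT proved; count-neutral (typed 28∕28; discharged count unchanged); N15 NOT discharged; one finite T⁴ at fixed ε — NOT infinite volume, NOT OS on
ℝ⁴, NOT a mass gap, NOT Clay.
-/

noncomputable section

open scoped BigOperators

namespace Summit.QuantumFields.YangMills.BalabanUVNodes.N15.SiteLayer

open Literature.MathematicalPhysics.QuantumFieldTheory.Balaban1983to89
open Literature.MathematicalPhysics.QuantumFieldTheory.Balaban1983to89.B11SectG (BlockNorm HasMaj RowSum)
open Literature.MathematicalPhysics.QuantumFieldTheory.Balaban1983to89.T4EtaRate (PairedInstance EtaRateIneqUnit NE2PlusUnit)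
open Literature.MathematicalPhysics.QuantumFieldTheory.Balaban1983to89.T4EtaRateDefect (idef)
open Literature.MathematicalPhysics.QuantumFieldTheory.Balaban1983to89.T4EtaRateCoeffDefect (pull diagK diagK_mono fibre)
open Literature.MathematicalPhysics.QuantumFieldTheory.Balaban1983to89.B6RandomWalk (Triangle254)
open Literature.MathematicalPhysics.QuantumFieldTheory.Balaban1983to89.B9SectDSup (inv_one_sub_le_two)
open Summit.QuantumFields.YangMills.BalabanUVNodes.N15.OperatorReadout (opGeo opGeo_len)
open Summit.QuantumFields.YangMills.BalabanUVNodes.N15.MatrixSpecies (liftMap liftBlk basisConst basisConst_nonneg)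
open Summit.QuantumFields.YangMills.BalabanUVNodes.N15.BackgroundLayer (blkPair liftPair bgConst bgConst_nonneg vWPert vWR gVWc35 le_gVWc35 vWC_letters_of_gauge
  v1coefC v1coefA v1fieldsOfGauge gavgM v1GaugeBg v1GaugeInstance)

/-! ## §1 Smallness arithmetic for the unit guard -/

section Small

/-- THE LINEAR BOUND of `cAmpU` in `a₀`: `cAmpU(β, Ka₀, c_r, r_Ka₀) ≤ a₀·cLinU` for `a₀ ≤ 1` under the operator guard. [folklore] -/
def cLinU (β K cr rK : ℝ) : ℝ := rK * ((2 * β) * (1 + rK * 1)) + (2 * β) * rK + β * (K * (2 * β)) * cr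

/-- `cLinU ≥ 0`. [folklore] -/
theorem cLinU_nonneg {β K cr rK : ℝ} (hβ : 0 ≤ β) (hK : 0 ≤ K) (hcr : 0 ≤ cr) (hrK : 0 ≤ rK) : 0 ≤ cLinU β K cr rK := by
  unfold cLinU; positivity

/-- **`cAmpU ≤ a₀·cLinU`** for `0 ≤ a₀ ≤ 1` and `β(Ka₀)c_r ≤ ½`. [folklore] -/
theorem cAmpU_le_lin {β K cr rK a₀ : ℝ} (hβ : 0 ≤ β) (hK : 0 ≤ K) (hcr : 0 ≤ cr) (hrK : 0 ≤ rK) (ha₀ : 0 ≤ a₀) (ha₀1 : a₀ ≤ 1)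
    (hq : β * (K * a₀) * cr ≤ 1 / 2) : cAmpU β (K * a₀) cr (rK * a₀) ≤ a₀ * cLinU β K cr rK := by
  have hqlt : β * (K * a₀) * cr < 1 := by linarith
  have hx0 : 0 ≤ xAmp β (K * a₀) cr := xAmp_nonneg hβ hqlt
  have hx : xAmp β (K * a₀) cr ≤ 2 * β := by
    unfold xAmp
    calc β * (1 - β * (K * a₀) * cr)⁻¹ ≤ β * 2 := mul_le_mul_of_nonneg_left (inv_one_sub_le_two hq) hβ
      _ = 2 * β := by ring
  set x := xAmp β (K * a₀) cr with hxdef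
  unfold cAmpU
  rw [← hxdef]
  calc rK * a₀ * (x * (1 + rK * a₀)) + x * (rK * a₀) + β * (K * a₀ * x) * cr
      ≤ rK * a₀ * ((2 * β) * (1 + rK * 1)) + (2 * β) * (rK * a₀) + β * (K * a₀ * (2 * β)) * cr := by gcongr
    _ = a₀ * cLinU β K cr rK := by unfold cLinU; ring

end Small

/-! ## §2 Per configuration: the dressed unit covariances' η-defect with the full perturbation live -/

section Config

variable {X X' Y J ι : Type} [Fintype X] [Fintype X'] [Fintype Y] [Fintype J] [Fintype ι] [DecidableEq X] [DecidableEq X'] [DecidableEq Y] [DecidableEq J]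
  [DecidableEq ι] {𝔄 : Type} [NormedRing 𝔄] [NormedAlgebra ℝ 𝔄] [CompleteSpace 𝔄] (e : 𝔄 ≃L[ℝ] (ι → ℝ)) {g : B6.Geometry} (blk : X → g.Site)
  (blkY : Y → g.Site) (q : X × ι → Y) (π : X' → X) (a : ℝ)
variable {G : (X × ι → ℝ) →ₗ[ℝ] (X × ι → ℝ)} {D : J ⊕ J → (X × ι → ℝ) →ₗ[ℝ] (X × ι → ℝ)} {G' : (X' × ι → ℝ) →ₗ[ℝ] (X' × ι → ℝ)}
  {D' : J ⊕ J → (X' × ι → ℝ) →ₗ[ℝ] (X' × ι → ℝ)}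

/-- **THE η-DEFECT OF THE DRESSED UNIT COVARIANCES WITH THE FULL PERTURBATION LIVE, PER CONFIGURATION** (S5's `hasMaj_idef_vWSiteC` with the unit form).  Data of F14's `vWC_letters_of_gauge` (one gauge field `A′` with
(3.35) at `c`, commuting shifts, `C_π`-step-connected fibres, block-translation law, species words `W, W′` at `c_W·(2c′Mα₀)`), guard `2(2c′)a₀ ≤ 1`, `a₀ ≤ 1`,
`β(gVWc35(2c′)a₀)c_r ≤ ½`; the `U ≡ 1` layer `G, D_μ` ∕ `G′, D′_μ` (`β·e^{−δd}`, defects `m₀θ·e^{−δd}`); averaging species `F₂, F₂*, F₂′, F₂*′ ≤ diagK (c_F·(2c′Mα₀))`, fits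
`≤ diagK (c_F·(2c′Mα₀)·θ)`; uniform pairing fibres of `liftMap π ι` over the site lattice `Y` (`liftBlk blk ι = blkY ∘ q`); `U ≡ 1` site kernels `W_s, W_s′ ≤ β_W·e^{−δd}`,
`(a − a²QGQ*)W_s = 1`, `(a − a²Q′G′Q′*)W_s′ = 1`; unit guard `β_W·a²cAmpU(β, Ka₀, c_r, c_F(2c′)a₀)·c_r² ≤ ½`; `4σ ≤ δ`.  CONCLUSION: `𝔇(C′, C) ≤ uAmp·θ·e^{−(δ−4σ)d}`.
[cite: Balaban1985BackgroundPropagators, (3.65)–(3.67) p.403 (mechanism); Thm 3.2 (3.48) p.398, (3.35) p.396, (3.60) p.402 (shapes)] -/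
theorem hasMaj_idef_vWUnitC (htri : Triangle254 g) (hd : ∀ a b : g.Site, 0 ≤ g.dist a b) {σ cr : ℝ} (hσ : 0 ≤ σ) (hcr : 0 ≤ cr) (hrow : RowSum g σ cr)
    {s : J → X ≃ X} {s' : J → X' ≃ X'} {N Nf : ℕ} {δ β m₀ θ c c' a₀ M α₀ η η' Cπ cW cF βW : ℝ} (hσδ : 4 * σ ≤ δ) (hβ : 0 ≤ β) (hm₀ : 0 ≤ m₀) (hθ : 0 ≤ θ)
    (hcomm : ∀ μ κ x, (s' μ).symm (s' κ x) = s' κ ((s' μ).symm x)) (hCπ : 0 ≤ Cπ)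
    (hconn : ∀ (f : X' → 𝔄) (b : ℝ), (∀ κ x, ‖f (s' κ x) - f x‖ ≤ b) → ∀ x₁ x₂, π x₁ = π x₂ → ‖f x₁ - f x₂‖ ≤ Cπ * b)
    (hblk : ∀ μ x', π ((s' μ ^ N) x') = s μ (π x')) (hη' : 0 < η') (hη'η : η' ≤ η) (hη1 : η ≤ 1) (hηθ : η ≤ θ) (hN : η = N * η')
    (hc : 0 ≤ c) (hc'0 : 0 < c') (hcc' : (2 + Fintype.card J) * c ≤ c') (hθ' : (1 + Fintype.card J) * Cπ * (c * M * α₀) * η' ≤ c' * M * α₀ * θ)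
    (hM : 1 ≤ M) (hα₀ : 0 < α₀) (hMα : M * α₀ ≤ a₀) (ha₀ : 0 ≤ a₀) (ha₀1 : 2 * (2 * c' * a₀) ≤ 1)
    (hq : β * (gVWc35 J (basisConst e) (2 * c') cW * a₀) * cr ≤ 1 / 2) (hcW : 0 ≤ cW) (hcF : 0 ≤ cF) (hβW : 0 ≤ βW)
    (hq2 : βW * (a * a * cAmpU β (gVWc35 J (basisConst e) (2 * c') cW * a₀) cr (cF * (2 * c') * a₀)) * cr * cr ≤ 1 / 2)
    (hqY : ∀ p, liftBlk blk ι p = blkY (q p)) (hNf : Nf ≠ 0) (hfib : ∀ x, (fibre (liftMap π ι) x).card = Nf)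
    (hG : HasMaj (BlockNorm.ofBlocks g (liftBlk blk ι)) (BlockNorm.ofBlocks g (liftBlk blk ι)) G (fun y y' => β * Real.exp (-(δ * g.dist y y'))))
    (hD : ∀ μ, HasMaj (BlockNorm.ofBlocks g (liftBlk blk ι)) (BlockNorm.ofBlocks g (liftBlk blk ι)) (D μ) (fun y y' => β * Real.exp (-(δ * g.dist y y'))))
    (hG' : HasMaj (BlockNorm.ofBlocks g (liftBlk (blk ∘ π) ι)) (BlockNorm.ofBlocks g (liftBlk (blk ∘ π) ι)) G' (fun y y' => β * Real.exp (-(δ * g.dist y y'))))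
    (hD' : ∀ μ, HasMaj (BlockNorm.ofBlocks g (liftBlk (blk ∘ π) ι)) (BlockNorm.ofBlocks g (liftBlk (blk ∘ π) ι)) (D' μ) (fun y y' => β * Real.exp (-(δ * g.dist y y'))))
    (hDG : HasMaj (BlockNorm.ofBlocks g (liftBlk blk ι)) (BlockNorm.ofBlocks g (liftBlk (blk ∘ π) ι))
      (idef (pull (liftMap π ι)) (pull (liftMap π ι)) G' G) (fun y y' => m₀ * θ * Real.exp (-(δ * g.dist y y'))))
    (hDD : ∀ μ, HasMaj (BlockNorm.ofBlocks g (liftBlk blk ι)) (BlockNorm.ofBlocks g (liftBlk (blk ∘ π) ι))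
      (idef (pull (liftMap π ι)) (pull (liftMap π ι)) (D' μ) (D μ)) (fun y y' => m₀ * θ * Real.exp (-(δ * g.dist y y'))))
    {A' : J → X' → 𝔄} (hreg : (v1GaugeBg 𝔄 J s' η' M).Reg335 c α₀ A')
    {W : (X × ι → ℝ) →ₗ[ℝ] (X × ι → ℝ)} {W' : (X' × ι → ℝ) →ₗ[ℝ] (X' × ι → ℝ)}
    (hW : HasMaj (BlockNorm.ofBlocks g (liftBlk blk ι)) (BlockNorm.ofBlocks g (liftBlk blk ι)) W (diagK fun _ => cW * (2 * c' * M * α₀)))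
    (hW' : HasMaj (BlockNorm.ofBlocks g (liftBlk (blk ∘ π) ι)) (BlockNorm.ofBlocks g (liftBlk (blk ∘ π) ι)) W' (diagK fun _ => cW * (2 * c' * M * α₀)))
    (hDW : HasMaj (BlockNorm.ofBlocks g (liftBlk blk ι)) (BlockNorm.ofBlocks g (liftBlk (blk ∘ π) ι))
      (idef (pull (liftMap π ι)) (pull (liftMap π ι)) W' W) (diagK fun _ => cW * (2 * c' * M * α₀) * θ))
    {F : (X × ι → ℝ) →ₗ[ℝ] (Y → ℝ)} {Fs : (Y → ℝ) →ₗ[ℝ] (X × ι → ℝ)} {F' : (X' × ι → ℝ) →ₗ[ℝ] (Y → ℝ)} {Fs' : (Y → ℝ) →ₗ[ℝ] (X' × ι → ℝ)}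
    (hF : HasMaj (BlockNorm.ofBlocks g (liftBlk blk ι)) (BlockNorm.ofBlocks g blkY) F (diagK fun _ => cF * (2 * c' * M * α₀)))
    (hFs : HasMaj (BlockNorm.ofBlocks g blkY) (BlockNorm.ofBlocks g (liftBlk blk ι)) Fs (diagK fun _ => cF * (2 * c' * M * α₀)))
    (hF' : HasMaj (BlockNorm.ofBlocks g (liftBlk (blk ∘ π) ι)) (BlockNorm.ofBlocks g blkY) F' (diagK fun _ => cF * (2 * c' * M * α₀)))
    (hFs' : HasMaj (BlockNorm.ofBlocks g blkY) (BlockNorm.ofBlocks g (liftBlk (blk ∘ π) ι)) Fs' (diagK fun _ => cF * (2 * c' * M * α₀)))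
    (hDF : HasMaj (BlockNorm.ofBlocks g (liftBlk blk ι)) (BlockNorm.ofBlocks g blkY) (idef (pull (liftMap π ι)) LinearMap.id F' F)
      (diagK fun _ => cF * (2 * c' * M * α₀) * θ))
    (hDFs : HasMaj (BlockNorm.ofBlocks g blkY) (BlockNorm.ofBlocks g (liftBlk (blk ∘ π) ι)) (idef LinearMap.id (pull (liftMap π ι)) Fs' Fs)
      (diagK fun _ => cF * (2 * c' * M * α₀) * θ))
    {Ws Ws' : (Y → ℝ) →ₗ[ℝ] (Y → ℝ)}
    (hWs : HasMaj (BlockNorm.ofBlocks g blkY) (BlockNorm.ofBlocks g blkY) Ws (fun y y' => βW * Real.exp (-(δ * g.dist y y'))))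
    (hWs' : HasMaj (BlockNorm.ofBlocks g blkY) (BlockNorm.ofBlocks g blkY) Ws' (fun y y' => βW * Real.exp (-(δ * g.dist y y'))))
    (hKW : unitForm₀ a q G ∘ₗ Ws = LinearMap.id) (hKW' : unitForm₀ a (q ∘ liftMap π ι) G' ∘ₗ Ws' = LinearMap.id) :
    HasMaj (BlockNorm.ofBlocks g blkY) (BlockNorm.ofBlocks g blkY)
      (idef LinearMap.id LinearMap.id
        (siteInv Ws' (unitForm₀ a (q ∘ liftMap π ι) G') (unitForm a (q ∘ liftMap π ι) F' Fs'
          (dressedOp G' D' (vWPert (v1coefC e η' (v1fieldsOfGauge 𝔄 J s' η' A')) (v1coefA e η' (v1fieldsOfGauge 𝔄 J s' η' A')) W'))))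
        (siteInv Ws (unitForm₀ a q G) (unitForm a q F Fs
          (dressedOp G D (vWPert (v1coefC e η (v1fieldsOfGauge 𝔄 J s η (gavgM 𝔄 J π A'))) (v1coefA e η (v1fieldsOfGauge 𝔄 J s η (gavgM 𝔄 J π A'))) W)))))
      (fun y y' => uAmp β (gVWc35 J (basisConst e) (2 * c') cW * a₀) cr (cF * (2 * c') * a₀) m₀ (gVWc35 J (basisConst e) (2 * c') cW) a₀
        (cF * (2 * c') * a₀) βW a * θ * Real.exp (-((δ - 4 * σ) * g.dist y y'))) := by
  obtain ⟨hR0, hRa, hV, hV', hDV⟩ :=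
    vWC_letters_of_gauge e (g := g) blk π hcomm hCπ hconn hblk hη' hη'η hη1 hηθ hN hc hc'0 hcc' hθ' hM hα₀ hMα ha₀1 hcW hreg hW hW' hDW
  set K : ℝ := gVWc35 J (basisConst e) (2 * c') cW with hKdef
  have hK : 0 ≤ K := (le_gVWc35 (J := J) (basisConst_nonneg e) (by positivity : 0 < 2 * c') hcW).2.1.le
  have hθ0 : 0 ≤ θ := hθ
  have hV₁ := hV.mono fun y y' => diagK_mono (fun _ => hRa) y y'
  have hV₁' := hV'.mono fun y y' => diagK_mono (fun _ => hRa) y y'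
  have hDV₁ := hDV.mono fun y y' => diagK_mono (fun _ => mul_le_mul_of_nonneg_right hRa hθ0) y y'
  have hr : cF * (2 * c' * M * α₀) ≤ cF * (2 * c') * a₀ := by
    have : 2 * c' * M * α₀ = 2 * c' * (M * α₀) := by ring
    rw [this, mul_assoc cF]
    exact mul_le_mul_of_nonneg_left (mul_le_mul_of_nonneg_left hMα (by positivity)) hcF
  have hr0 : 0 ≤ cF * (2 * c') * a₀ := by positivity
  have hF₁ := hF.mono fun y y' => diagK_mono (fun _ => hr) y y'
  have hFs₁ := hFs.mono fun y y' => diagK_mono (fun _ => hr) y y'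
  have hF₁' := hF'.mono fun y y' => diagK_mono (fun _ => hr) y y'
  have hFs₁' := hFs'.mono fun y y' => diagK_mono (fun _ => hr) y y'
  have hDF₁ := hDF.mono fun y y' => diagK_mono (fun _ => mul_le_mul_of_nonneg_right hr hθ0) y y'
  have hDFs₁ := hDFs.mono fun y y' => diagK_mono (fun _ => mul_le_mul_of_nonneg_right hr hθ0) y y'
  exact hasMaj_idef_dressedUnit htri hd hrow hσ hcr (liftBlk blk ι) blkY q (liftMap π ι) hqY hNf hfib a hσδ hβ hm₀ hθ hK ha₀ hq (mul_nonneg hK ha₀) le_rfl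
    hr0 hr0 hβW hq2 hG hD hG' hD' hDG hDD hV₁ hV₁' hDV₁ hF₁ hFs₁ hF₁' hFs₁' hDF₁ hDFs₁ hWs hWs' hKW hKW'

end Config

/-! ## §3 The unit-covariance family on the gauge paired instances, and the node's third conjunct BY NAME -/

section Node

variable {I J ι : Type} [Fintype J] [DecidableEq J] [Fintype ι] [DecidableEq ι] {𝔄 : Type} [NormedRing 𝔄] [NormedAlgebra ℝ 𝔄] [CompleteSpace 𝔄]
  (e : 𝔄 ≃L[ℝ] (ι → ℝ)) (g : I → B6.Geometry) (X X' Y : I → Type) [∀ i, Fintype (X i)] [∀ i, Fintype (X' i)] [∀ i, Fintype (Y i)] [∀ i, DecidableEq (X i)]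
  [∀ i, DecidableEq (X' i)] [∀ i, DecidableEq (Y i)] (blk : ∀ i, X i → (g i).Site) (blkY : ∀ i, Y i → (g i).Site) (q : ∀ i, X i × ι → Y i)
  (π : ∀ i, X' i → X i) (nsh : I → ℕ) (hL0 : ∀ i, (g i).L ≠ 0) (θ : I → ℝ)
  (G : ∀ i, (X i × ι → ℝ) →ₗ[ℝ] (X i × ι → ℝ)) (D : ∀ i, J ⊕ J → (X i × ι → ℝ) →ₗ[ℝ] (X i × ι → ℝ))
  (G' : ∀ i, (X' i × ι → ℝ) →ₗ[ℝ] (X' i × ι → ℝ)) (D' : ∀ i, J ⊕ J → (X' i × ι → ℝ) →ₗ[ℝ] (X' i × ι → ℝ))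
  (s : ∀ i, J → X i ≃ X i) (s' : ∀ i, J → X' i ≃ X' i) (Cπ : I → ℝ) (Nst Nf : I → ℕ)
  (Wc : ∀ i, (J → X' i → 𝔄) → ((X i × ι → ℝ) →ₗ[ℝ] (X i × ι → ℝ))) (Wf : ∀ i, (J → X' i → 𝔄) → ((X' i × ι → ℝ) →ₗ[ℝ] (X' i × ι → ℝ)))
  (Fc : ∀ i, (J → X' i → 𝔄) → ((X i × ι → ℝ) →ₗ[ℝ] (Y i → ℝ))) (Fsc : ∀ i, (J → X' i → 𝔄) → ((Y i → ℝ) →ₗ[ℝ] (X i × ι → ℝ)))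
  (Ff : ∀ i, (J → X' i → 𝔄) → ((X' i × ι → ℝ) →ₗ[ℝ] (Y i → ℝ))) (Fsf : ∀ i, (J → X' i → 𝔄) → ((Y i → ℝ) →ₗ[ℝ] (X' i × ι → ℝ)))
  (Ws Ws' : ∀ i, (Y i → ℝ) →ₗ[ℝ] (Y i → ℝ)) (a : ℝ)

/-- THE UNIT-LAYER OPS at a fine gauge field `A′` of instance `i`: the η-difference (common site lattice, identity transports) of the fine dressed unit covariance at `A′`
(spacing `η′_i = η_i(L^{n_i})⁻¹`, `V′₁` coefficients at the fine triple, word `Wf i A′`, species `Ff i A′`, `Fsf i A′`, `U ≡ 1` unit covariance `Ws′ i`) and the coarse one at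
the mean field's triple (`η_i`, `Wc i A′`, `Fc i A′`, `Fsc i A′`, `Ws i`). [cite: King1986, (4.33) p.673 + Lemma 4.5 (4.38) p.674 (shapes)] -/
def vWUnitOpsC (i : I) : (J → X' i → 𝔄) → ((Y i → ℝ) →ₗ[ℝ] (Y i → ℝ)) := fun A' =>
  idef LinearMap.id LinearMap.id
    (siteInv (Ws' i) (unitForm₀ a (q i ∘ liftMap (π i) ι) (G' i)) (unitForm a (q i ∘ liftMap (π i) ι) (Ff i A') (Fsf i A')
      (dressedOp (G' i) (D' i) (vWPert (v1coefC e ((g i).eta * ((g i).L ^ nsh i)⁻¹) (v1fieldsOfGauge 𝔄 J (s' i) ((g i).eta * ((g i).L ^ nsh i)⁻¹) A'))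
        (v1coefA e ((g i).eta * ((g i).L ^ nsh i)⁻¹) (v1fieldsOfGauge 𝔄 J (s' i) ((g i).eta * ((g i).L ^ nsh i)⁻¹) A')) (Wf i A')))))
    (siteInv (Ws i) (unitForm₀ a (q i) (G i)) (unitForm a (q i) (Fc i A') (Fsc i A')
      (dressedOp (G i) (D i) (vWPert (v1coefC e (g i).eta (v1fieldsOfGauge 𝔄 J (s i) (g i).eta (gavgM 𝔄 J (π i) A')))
        (v1coefA e (g i).eta (v1fieldsOfGauge 𝔄 J (s i) (g i).eta (gavgM 𝔄 J (π i) A'))) (Wc i A')))))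

/-- THE UNIT-COVARIANCE KERNEL FAMILY on g3's gauge paired instances: `siteKernelOf` of `vWUnitOpsC`. [cite: Balaban1985BackgroundPropagators, Thm 3.15 (3.187) p.432 (shape)] -/
def vWGCUnitKernel (i : I) :
    B9.SiteKernel (v1GaugeInstance 𝔄 J ι (blk i) (π i) (s i) (s' i) (nsh i) (hL0 i)).gc (v1GaugeInstance 𝔄 J ι (blk i) (π i) (s i) (s' i) (nsh i) (hL0 i)).Bf :=
  show B9.SiteKernel (opGeo (g i) (X i × ι) (liftBlk (blk i) ι)) (v1GaugeBg 𝔄 J (s' i) ((g i).eta * ((g i).L ^ nsh i)⁻¹) (g i).M) from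
    siteKernelOf (liftBlk (blk i) ι) (blkY i) (vWUnitOpsC e g X X' Y q π nsh G D G' D' s s' Wc Wf Fc Fsc Ff Fsf Ws Ws' a i)
set_option maxHeartbeats 400000 in
/-- **NE2⁺, UNIT-LATTICE LAYER — `T4EtaRate.NE2PlusUnit c₃₅` BY NAME, (3.60)-SHAPED FULL PERTURBATION LIVE, GAUGE FIELD THE DATUM** — S5's `ne2PlusSite_vWGC` for the
dressed unit covariances: the SAME gauge paired instances and structural hypotheses, PLUS a uniform rate number `0 < θ₀ < 1` with `θ_i ≤ θ₀^{k_i}` and `M_i ≥ 1` (the unit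
layer's quantifier block has no `M₅` guard), the `U ≡ 1` UNIT COVARIANCES `Ws i, Ws′ i` (uniform majorant `β_W·e^{−δd}`, inverting `a − a²QGQ*` ∕ `a − a²Q′G′Q′*`) ⟹
`NE2PlusUnit c₃₅ pi (vWGCUnitKernel …) ⊤ d` (inside: `δ₀ = δ − 4σ`, `a₀ = min a₁ a₂`, `B₀ = uAmp + 1`, `θ = θ₀`; the (3.36) slot is not consumed).  NOT PRINTED (no η-rate is);
N15's third conjunct for a background-live family, the `U ≡ 1` unit covariances displayed. [cite: Balaban1985BackgroundPropagators, Thm 3.15 (3.187) p.432 (quantifier template); King1986, (4.33) p.673, Lemma 4.5 (4.38) p.674 (shapes); Balaban1985BackgroundPropagators, (3.35) p.396, (3.60) p.402, (3.65)–(3.67) p.403 (shapes, mechanism)] -/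
theorem ne2PlusUnit_vWGC (c35 : ℝ) (hc35 : 0 < c35) {θ₀ : ℝ} (hθ₀ : 0 < θ₀) (hθ₁ : θ₀ < 1) (hθk : ∀ i, θ i ≤ θ₀ ^ (g i).k)
    (hM1 : ∀ i, 1 ≤ (g i).M)
    (htri : ∀ i, Triangle254 (g i)) (hd : ∀ i (a b : (g i).Site), 0 ≤ (g i).dist a b) {σ cr : ℝ} (hσ : 0 ≤ σ) (hcr : 0 ≤ cr)
    (hrow : ∀ i, RowSum (g i) σ cr) (hη : ∀ i, 0 < (g i).eta) (hη1 : ∀ i, (g i).eta ≤ 1) (hηθ : ∀ i, (g i).eta ≤ θ i) (hL : ∀ i, 1 ≤ (g i).L)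
    {δ β m₀ cW cF βW : ℝ} (hσδ : 4 * σ < δ) (hβ : 0 ≤ β) (hm₀ : 0 ≤ m₀)
    (hcomm : ∀ i μ κ x, (s' i μ).symm (s' i κ x) = s' i κ ((s' i μ).symm x)) (hCπ : ∀ i, 0 ≤ Cπ i)
    (hconn : ∀ i (f : X' i → 𝔄) (b : ℝ), (∀ κ x, ‖f (s' i κ x) - f x‖ ≤ b) → ∀ x₁ x₂, π i x₁ = π i x₂ → ‖f x₁ - f x₂‖ ≤ Cπ i * b)
    {C₀ : ℝ} (hC₀ : 0 ≤ C₀) (hCθ : ∀ i, Cπ i * ((g i).eta * ((g i).L ^ nsh i)⁻¹) ≤ C₀ * θ i) (hcW : 0 ≤ cW) (hcF : 0 ≤ cF) (hβW : 0 ≤ βW)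
    (hblk : ∀ i μ x', π i ((s' i μ ^ Nst i) x') = s i μ (π i x')) (hN : ∀ i, (g i).eta = Nst i * ((g i).eta * ((g i).L ^ nsh i)⁻¹))
    (hqY : ∀ i pt, liftBlk (blk i) ι pt = blkY i (q i pt)) (hNf : ∀ i, Nf i ≠ 0) (hfib : ∀ i x, (fibre (liftMap (π i) ι) x).card = Nf i)
    (hWc : ∀ i (α₀ : ℝ) A', 0 < α₀ → 2 * (c35 * ((g i).M * α₀)) ≤ 1 → (v1GaugeBg 𝔄 J (s' i) ((g i).eta * ((g i).L ^ nsh i)⁻¹) (g i).M).Reg335 c35 α₀ A' →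
      HasMaj (BlockNorm.ofBlocks (g i) (liftBlk (blk i) ι)) (BlockNorm.ofBlocks (g i) (liftBlk (blk i) ι)) (Wc i A') (diagK fun _ => cW * (c35 * (g i).M * α₀)))
    (hWf : ∀ i (α₀ : ℝ) A', 0 < α₀ → 2 * (c35 * ((g i).M * α₀)) ≤ 1 → (v1GaugeBg 𝔄 J (s' i) ((g i).eta * ((g i).L ^ nsh i)⁻¹) (g i).M).Reg335 c35 α₀ A' →
      HasMaj (BlockNorm.ofBlocks (g i) (liftBlk (blk i ∘ π i) ι)) (BlockNorm.ofBlocks (g i) (liftBlk (blk i ∘ π i) ι)) (Wf i A')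
        (diagK fun _ => cW * (c35 * (g i).M * α₀)))
    (hDW : ∀ i (α₀ : ℝ) A', 0 < α₀ → 2 * (c35 * ((g i).M * α₀)) ≤ 1 → (v1GaugeBg 𝔄 J (s' i) ((g i).eta * ((g i).L ^ nsh i)⁻¹) (g i).M).Reg335 c35 α₀ A' →
      HasMaj (BlockNorm.ofBlocks (g i) (liftBlk (blk i) ι)) (BlockNorm.ofBlocks (g i) (liftBlk (blk i ∘ π i) ι))
        (idef (pull (liftMap (π i) ι)) (pull (liftMap (π i) ι)) (Wf i A') (Wc i A')) (diagK fun _ => cW * (c35 * (g i).M * α₀) * θ i))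
    (hFc : ∀ i (α₀ : ℝ) A', 0 < α₀ → 2 * (c35 * ((g i).M * α₀)) ≤ 1 → (v1GaugeBg 𝔄 J (s' i) ((g i).eta * ((g i).L ^ nsh i)⁻¹) (g i).M).Reg335 c35 α₀ A' →
      HasMaj (BlockNorm.ofBlocks (g i) (liftBlk (blk i) ι)) (BlockNorm.ofBlocks (g i) (blkY i)) (Fc i A') (diagK fun _ => cF * (c35 * (g i).M * α₀)))
    (hFsc : ∀ i (α₀ : ℝ) A', 0 < α₀ → 2 * (c35 * ((g i).M * α₀)) ≤ 1 → (v1GaugeBg 𝔄 J (s' i) ((g i).eta * ((g i).L ^ nsh i)⁻¹) (g i).M).Reg335 c35 α₀ A' →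
      HasMaj (BlockNorm.ofBlocks (g i) (blkY i)) (BlockNorm.ofBlocks (g i) (liftBlk (blk i) ι)) (Fsc i A') (diagK fun _ => cF * (c35 * (g i).M * α₀)))
    (hFf : ∀ i (α₀ : ℝ) A', 0 < α₀ → 2 * (c35 * ((g i).M * α₀)) ≤ 1 → (v1GaugeBg 𝔄 J (s' i) ((g i).eta * ((g i).L ^ nsh i)⁻¹) (g i).M).Reg335 c35 α₀ A' →
      HasMaj (BlockNorm.ofBlocks (g i) (liftBlk (blk i ∘ π i) ι)) (BlockNorm.ofBlocks (g i) (blkY i)) (Ff i A') (diagK fun _ => cF * (c35 * (g i).M * α₀)))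
    (hFsf : ∀ i (α₀ : ℝ) A', 0 < α₀ → 2 * (c35 * ((g i).M * α₀)) ≤ 1 → (v1GaugeBg 𝔄 J (s' i) ((g i).eta * ((g i).L ^ nsh i)⁻¹) (g i).M).Reg335 c35 α₀ A' →
      HasMaj (BlockNorm.ofBlocks (g i) (blkY i)) (BlockNorm.ofBlocks (g i) (liftBlk (blk i ∘ π i) ι)) (Fsf i A') (diagK fun _ => cF * (c35 * (g i).M * α₀)))
    (hDF : ∀ i (α₀ : ℝ) A', 0 < α₀ → 2 * (c35 * ((g i).M * α₀)) ≤ 1 → (v1GaugeBg 𝔄 J (s' i) ((g i).eta * ((g i).L ^ nsh i)⁻¹) (g i).M).Reg335 c35 α₀ A' →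
      HasMaj (BlockNorm.ofBlocks (g i) (liftBlk (blk i) ι)) (BlockNorm.ofBlocks (g i) (blkY i))
        (idef (pull (liftMap (π i) ι)) LinearMap.id (Ff i A') (Fc i A')) (diagK fun _ => cF * (c35 * (g i).M * α₀) * θ i))
    (hDFs : ∀ i (α₀ : ℝ) A', 0 < α₀ → 2 * (c35 * ((g i).M * α₀)) ≤ 1 → (v1GaugeBg 𝔄 J (s' i) ((g i).eta * ((g i).L ^ nsh i)⁻¹) (g i).M).Reg335 c35 α₀ A' →
      HasMaj (BlockNorm.ofBlocks (g i) (blkY i)) (BlockNorm.ofBlocks (g i) (liftBlk (blk i ∘ π i) ι))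
        (idef LinearMap.id (pull (liftMap (π i) ι)) (Fsf i A') (Fsc i A')) (diagK fun _ => cF * (c35 * (g i).M * α₀) * θ i))
    (hG : ∀ i, HasMaj (BlockNorm.ofBlocks (g i) (liftBlk (blk i) ι)) (BlockNorm.ofBlocks (g i) (liftBlk (blk i) ι)) (G i)
      (fun y y' => β * Real.exp (-(δ * (g i).dist y y'))))
    (hD : ∀ i μ, HasMaj (BlockNorm.ofBlocks (g i) (liftBlk (blk i) ι)) (BlockNorm.ofBlocks (g i) (liftBlk (blk i) ι)) (D i μ)
      (fun y y' => β * Real.exp (-(δ * (g i).dist y y'))))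
    (hG' : ∀ i, HasMaj (BlockNorm.ofBlocks (g i) (liftBlk (blk i ∘ π i) ι)) (BlockNorm.ofBlocks (g i) (liftBlk (blk i ∘ π i) ι)) (G' i)
      (fun y y' => β * Real.exp (-(δ * (g i).dist y y'))))
    (hD' : ∀ i μ, HasMaj (BlockNorm.ofBlocks (g i) (liftBlk (blk i ∘ π i) ι)) (BlockNorm.ofBlocks (g i) (liftBlk (blk i ∘ π i) ι)) (D' i μ)
      (fun y y' => β * Real.exp (-(δ * (g i).dist y y'))))
    (hDG : ∀ i, HasMaj (BlockNorm.ofBlocks (g i) (liftBlk (blk i) ι)) (BlockNorm.ofBlocks (g i) (liftBlk (blk i ∘ π i) ι))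
      (idef (pull (liftMap (π i) ι)) (pull (liftMap (π i) ι)) (G' i) (G i)) (fun y y' => m₀ * θ i * Real.exp (-(δ * (g i).dist y y'))))
    (hDD : ∀ i μ, HasMaj (BlockNorm.ofBlocks (g i) (liftBlk (blk i) ι)) (BlockNorm.ofBlocks (g i) (liftBlk (blk i ∘ π i) ι))
      (idef (pull (liftMap (π i) ι)) (pull (liftMap (π i) ι)) (D' i μ) (D i μ)) (fun y y' => m₀ * θ i * Real.exp (-(δ * (g i).dist y y'))))
    (hWs : ∀ i, HasMaj (BlockNorm.ofBlocks (g i) (blkY i)) (BlockNorm.ofBlocks (g i) (blkY i)) (Ws i) (fun y y' => βW * Real.exp (-(δ * (g i).dist y y'))))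
    (hWs' : ∀ i, HasMaj (BlockNorm.ofBlocks (g i) (blkY i)) (BlockNorm.ofBlocks (g i) (blkY i)) (Ws' i) (fun y y' => βW * Real.exp (-(δ * (g i).dist y y'))))
    (hKW : ∀ i, unitForm₀ a (q i) (G i) ∘ₗ Ws i = LinearMap.id) (hKW' : ∀ i, unitForm₀ a (q i ∘ liftMap (π i) ι) (G' i) ∘ₗ Ws' i = LinearMap.id) :
    NE2PlusUnit c35 (fun i => v1GaugeInstance 𝔄 J ι (blk i) (π i) (s i) (s' i) (nsh i) (hL0 i))
      (vWGCUnitKernel e g X X' Y blk blkY q π nsh hL0 G D G' D' s s' Wc Wf Fc Fsc Ff Fsf Ws Ws' a) (fun _ _ => True) (fun i => (g i).dist) := by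
  have hJ0 : (0 : ℝ) ≤ Fintype.card J := Nat.cast_nonneg _
  set c' : ℝ := (2 + Fintype.card J) * (1 + C₀) * c35 with hc'
  have hc'pos : 0 < c' := by positivity
  have hc35c' : c35 ≤ 2 * c' := by
    rw [hc']
    have h1 : (1 : ℝ) ≤ 2 * ((2 + Fintype.card J) * (1 + C₀)) := by nlinarith [mul_nonneg hJ0 hC₀]
    nlinarith
  have h2c'pos : 0 < 2 * c' := by positivity
  obtain ⟨hcg, hgpos, _⟩ := le_gVWc35 (J := J) (basisConst_nonneg e) h2c'pos hcW
  have hP : 0 ≤ a * a * cLinU β (gVWc35 J (basisConst e) (2 * c') cW) cr (cF * (2 * c')) :=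
    mul_nonneg (mul_self_nonneg a) (cLinU_nonneg hβ hgpos.le hcr (by positivity))
  obtain ⟨a₀, ha₀, ha₀le, hq, ha₀1, hq2P⟩ := site_thresholds hβ hcr hgpos hcg hc'pos hP hβW
  have hq2 : βW * (a * a * cAmpU β (gVWc35 J (basisConst e) (2 * c') cW * a₀) cr (cF * (2 * c') * a₀)) * cr * cr ≤ 1 / 2 := by
    have hle := cAmpU_le_lin (β := β) (K := gVWc35 J (basisConst e) (2 * c') cW) (cr := cr) (rK := cF * (2 * c')) hβ hgpos.le hcr (by positivity)
      ha₀.le ha₀le hq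
    have hle' : a * a * cAmpU β (gVWc35 J (basisConst e) (2 * c') cW * a₀) cr (cF * (2 * c') * a₀) ≤
        a₀ * (a * a * cLinU β (gVWc35 J (basisConst e) (2 * c') cW) cr (cF * (2 * c'))) := by
      have := mul_le_mul_of_nonneg_left hle (mul_self_nonneg a)
      linarith [this]
    have h1 : βW * (a * a * cAmpU β (gVWc35 J (basisConst e) (2 * c') cW * a₀) cr (cF * (2 * c') * a₀)) * cr * cr ≤
        βW * (a₀ * (a * a * cLinU β (gVWc35 J (basisConst e) (2 * c') cW) cr (cF * (2 * c')))) * cr * cr :=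
      mul_le_mul_of_nonneg_right (mul_le_mul_of_nonneg_right (mul_le_mul_of_nonneg_left hle' hβW) hcr) hcr
    exact h1.trans hq2P
  have hqlt : β * (gVWc35 J (basisConst e) (2 * c') cW * a₀) * cr < 1 := by linarith
  have hq2lt : βW * (a * a * cAmpU β (gVWc35 J (basisConst e) (2 * c') cW * a₀) cr (cF * (2 * c') * a₀)) * cr * cr < 1 := by linarith
  have hC : 0 ≤ uAmp β (gVWc35 J (basisConst e) (2 * c') cW * a₀) cr (cF * (2 * c') * a₀) m₀ (gVWc35 J (basisConst e) (2 * c') cW) a₀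
      (cF * (2 * c') * a₀) βW a := uAmp_nonneg hβ hcr (by positivity) hm₀ hgpos.le ha₀.le (by positivity) hβW hqlt hq2lt
  generalize hCdef : uAmp β (gVWc35 J (basisConst e) (2 * c') cW * a₀) cr (cF * (2 * c') * a₀) m₀ (gVWc35 J (basisConst e) (2 * c') cW) a₀
      (cF * (2 * c') * a₀) βW a = C at hC
  refine ⟨δ - 4 * σ, a₀, C + 1, θ₀, by linarith, ha₀, by linarith, hθ₀, hθ₁, fun i α₀ hα₀ hMα A' hreg _ => ?_⟩
  have hM' : 1 ≤ (g i).M := hM1 i; have hMα' : (g i).M * α₀ ≤ a₀ := hMα; have hM0 : 0 ≤ (g i).M := zero_le_one.trans hM'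
  have hLpos : 0 < (g i).L := lt_of_lt_of_le one_pos (hL i)
  have hη'pos : 0 < (g i).eta * ((g i).L ^ nsh i)⁻¹ := mul_pos (hη i) (inv_pos.2 (pow_pos hLpos _))
  have hη'η : (g i).eta * ((g i).L ^ nsh i)⁻¹ ≤ (g i).eta := by
    have h1 : ((g i).L ^ nsh i)⁻¹ ≤ 1 := inv_le_one_of_one_le₀ (one_le_pow₀ (hL i))
    calc (g i).eta * ((g i).L ^ nsh i)⁻¹ ≤ (g i).eta * 1 := mul_le_mul_of_nonneg_left h1 (hη i).le
      _ = (g i).eta := mul_one _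
  have hθ0 : 0 ≤ θ i := (hη i).le.trans (hηθ i)
  have hcc' : (2 + Fintype.card J) * c35 ≤ c' := by
    rw [hc']
    have h0 : 0 ≤ (2 + Fintype.card J) * c35 := by positivity
    nlinarith [mul_nonneg hC₀ h0]
  have hθ' : (1 + Fintype.card J) * Cπ i * (c35 * (g i).M * α₀) * ((g i).eta * ((g i).L ^ nsh i)⁻¹) ≤ c' * (g i).M * α₀ * θ i := by
    have h0 : 0 ≤ (1 + Fintype.card J) * (c35 * (g i).M * α₀) := by positivity
    have hMα0 : 0 ≤ (g i).M * α₀ := mul_nonneg hM0 hα₀.le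
    have hcoef : (1 + Fintype.card J) * C₀ * c35 ≤ c' := by
      rw [hc']; nlinarith [mul_nonneg hC₀ hJ0, hc35.le, mul_nonneg (mul_nonneg hC₀ hJ0) hc35.le, mul_nonneg hJ0 hc35.le, mul_nonneg hC₀ hc35.le]
    calc (1 + Fintype.card J) * Cπ i * (c35 * (g i).M * α₀) * ((g i).eta * ((g i).L ^ nsh i)⁻¹)
        = (1 + Fintype.card J) * (c35 * (g i).M * α₀) * (Cπ i * ((g i).eta * ((g i).L ^ nsh i)⁻¹)) := by ring
      _ ≤ (1 + Fintype.card J) * (c35 * (g i).M * α₀) * (C₀ * θ i) := mul_le_mul_of_nonneg_left (hCθ i) h0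
      _ = ((1 + Fintype.card J) * C₀ * c35) * ((g i).M * α₀) * θ i := by ring
      _ ≤ c' * ((g i).M * α₀) * θ i := mul_le_mul_of_nonneg_right (mul_le_mul_of_nonneg_right hcoef hMα0) hθ0
      _ = c' * (g i).M * α₀ * θ i := by ring
  have hregA : (v1GaugeBg 𝔄 J (s' i) ((g i).eta * ((g i).L ^ nsh i)⁻¹) (g i).M).Reg335 c35 α₀ A' := hreg
  have hmono : c35 * (g i).M * α₀ ≤ 2 * c' * (g i).M * α₀ := mul_le_mul_of_nonneg_right (mul_le_mul_of_nonneg_right hc35c' hM0) hα₀.le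
  have hmW : cW * (c35 * (g i).M * α₀) ≤ cW * (2 * c' * (g i).M * α₀) := mul_le_mul_of_nonneg_left hmono hcW
  have hmF : cF * (c35 * (g i).M * α₀) ≤ cF * (2 * c' * (g i).M * α₀) := mul_le_mul_of_nonneg_left hmono hcF
  have hsm : 2 * (c35 * ((g i).M * α₀)) ≤ 1 :=
    (mul_le_mul_of_nonneg_left ((mul_le_mul_of_nonneg_left hMα' hc35.le).trans (mul_le_mul_of_nonneg_right hc35c' ha₀.le)) zero_le_two).trans ha₀1
  have hWc' := (hWc i α₀ A' hα₀ hsm hregA).mono fun y y' => diagK_mono (fun _ => hmW) y y'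
  have hWf' := (hWf i α₀ A' hα₀ hsm hregA).mono fun y y' => diagK_mono (fun _ => hmW) y y'
  have hDW' := (hDW i α₀ A' hα₀ hsm hregA).mono fun y y' => diagK_mono (fun _ => mul_le_mul_of_nonneg_right hmW hθ0) y y'
  have hFc' := (hFc i α₀ A' hα₀ hsm hregA).mono fun y y' => diagK_mono (fun _ => hmF) y y'
  have hFsc' := (hFsc i α₀ A' hα₀ hsm hregA).mono fun y y' => diagK_mono (fun _ => hmF) y y'
  have hFf' := (hFf i α₀ A' hα₀ hsm hregA).mono fun y y' => diagK_mono (fun _ => hmF) y y'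
  have hFsf' := (hFsf i α₀ A' hα₀ hsm hregA).mono fun y y' => diagK_mono (fun _ => hmF) y y'
  have hDF' := (hDF i α₀ A' hα₀ hsm hregA).mono fun y y' => diagK_mono (fun _ => mul_le_mul_of_nonneg_right hmF hθ0) y y'
  have hDFs' := (hDFs i α₀ A' hα₀ hsm hregA).mono fun y y' => diagK_mono (fun _ => mul_le_mul_of_nonneg_right hmF hθ0) y y'
  have key := hasMaj_idef_vWUnitC e (blk i) (blkY i) (q i) (π i) a (htri i) (hd i) hσ hcr (hrow i) hσδ.le hβ hm₀ hθ0 (hcomm i) (hCπ i) (hconn i) (hblk i)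
    hη'pos hη'η (hη1 i) (hηθ i) (hN i) hc35.le hc'pos hcc' hθ' hM' hα₀ hMα' ha₀.le ha₀1 hq hcW hcF hβW hq2 (hqY i) (hNf i) (hfib i) (hG i) (hD i) (hG' i)
    (hD' i) (hDG i) (hDD i) hregA hWc' hWf' hDW' hFc' hFsc' hFf' hFsf' hDF' hDFs' (hWs i) (hWs' i) (hKW i) (hKW' i)
  rw [hCdef] at key
  have key' : HasMaj (BlockNorm.ofBlocks (g i) (blkY i)) (BlockNorm.ofBlocks (g i) (blkY i))
      (vWUnitOpsC e g X X' Y q π nsh G D G' D' s s' Wc Wf Fc Fsc Ff Fsf Ws Ws' a i A')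
      (fun y y' => (C + 1) * Real.exp (-((δ - 4 * σ) * (g i).dist y y')) * θ₀ ^ (g i).k) := by
    refine key.mono fun y y' => ?_
    have hE : 0 ≤ Real.exp (-((δ - 4 * σ) * (g i).dist y y')) := Real.exp_nonneg _
    calc C * θ i * Real.exp (-((δ - 4 * σ) * (g i).dist y y'))
        = C * Real.exp (-((δ - 4 * σ) * (g i).dist y y')) * θ i := by ring
      _ ≤ (C + 1) * Real.exp (-((δ - 4 * σ) * (g i).dist y y')) * θ₀ ^ (g i).k :=
          mul_le_mul (mul_le_mul_of_nonneg_right (by linarith) hE) (hθk i) hθ0 (mul_nonneg (by linarith) hE)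
  have hC1 : 0 ≤ C + 1 := by linarith
  have fin := etaRateIneqUnit_opGeo_of_hasMaj (B := v1GaugeBg 𝔄 J (s' i) ((g i).eta * ((g i).L ^ nsh i)⁻¹) (g i).M)
    (liftBlk (blk i) ι) (blkY i) (g i).k hC1 hθ₀.le (vWUnitOpsC e g X X' Y q π nsh G D G' D' s s' Wc Wf Fc Fsc Ff Fsf Ws Ws' a i) A' key'
  intro y y' hy hy'
  exact fin y y' hy hy'

end Node

end Summit.QuantumFields.YangMills.BalabanUVNodes.N15.SiteLayer

end
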